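import Literature.NumberTheory.Adeles.StableLatticeSaturation
import HarnessLib

/-!
# Congruence brick for saturated lattices: `γ′ Y γ′⁻¹ ≡ 0 (mod N)` from a coefficient identity `Y·Aₗ = Σₘ βₘₗ Aₘ`

Companion of ★ `forall_mem_integral_conj_of_sum` (the INTEGRALITY brick of
[cite: PlatonovRapinchuk1994, §8.1]).  There the lattice `Λ′ = Σₗ Aₗ Λ = γ′⁻¹ℤ^N` built from
`Λ = γ⁻¹ℤ^N` (`γ′⁻¹ = Σₗ Aₗ γ⁻¹ Bₗ`, `Aₗ γ⁻¹ = γ′⁻¹ Dₗ`, integer `Bₗ, Dₗ`) inherits stability; here it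
inherits CONGRUENCES: if an adelic matrix `Y` satisfies `Y·Aₗ = Σₘ βₘₗ·Aₘ` with all `βₘₗ ∈ N·ℤ̂`
(`levelIdeal N`), then `γ′ Y γ′⁻¹ = Σₗ Σₘ βₘₗ · Dₘ Bₗ` has all its entries in `N·ℤ̂`, i.e.
`γ′ (1 + Y) γ′⁻¹ ≡ 1 (mod N)`.  In the application (Deligne's auxiliary level,
[cite: Deligne1971TravauxShimura, Prop. 1.15 p. 132]) `Aₘ` is multiplication by the `m`-th basis
vector of a lattice `Λ₀ ⊂ M` on `V_M`, `Y` is multiplication by `t − 1` for a torus element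
`t ≡ 1 (mod N)` on `Λ̂₀`, and the conclusion is `t ≡ 1 (mod N)` on the product lattice `Λ₀ · Λ`.

Also: the common-denominator lemma for finitely many rationals (`exists_nat_forall_int_eq_mul`).

Topic `NumberTheory/Adeles`; namespace `Literature.NumberTheory.Adeles`.  Theorems only.
-/

noncomputable section

open scoped Matrix
open NumberField IsDedekindDomain Matrix
open Literature.NumberTheory.Automorphic (integralFiniteAdeles)
open Literature.AlgebraicGeometry.ModuliOfAbelianVarieties (finAdeleQ levelIdeal IsCongOne
  mul_mem_levelIdeal_of_mem_integralAdeles)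

namespace Literature.NumberTheory.Adeles

variable {N : Type} [Fintype N] {ι : Type} [Fintype ι]

/-- **Common denominator**: finitely many rationals `f a` become integers after multiplication by
one positive natural number `D` (the product of their denominators) — the commensurability step «a finitely
generated `ℤ`-submodule of `ℚ^N` lies in `D⁻¹ℤ^N`». [cite: PlatonovRapinchuk1994, §8.1] -/
theorem exists_nat_forall_int_eq_mul {α : Type} [Fintype α] (f : α → ℚ) :
    ∃ D : ℕ, D ≠ 0 ∧ ∀ a, ∃ z : ℤ, (z : ℚ) = (D : ℚ) * f a := by
  classical
  refine ⟨∏ a, (f a).den, ?_, fun a => ?_⟩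
  · exact Finset.prod_ne_zero_iff.2 fun a _ => (f a).den_nz
  · refine ⟨(∏ a' ∈ Finset.univ.erase a, ((f a').den : ℤ)) * (f a).num, ?_⟩
    rw [← Finset.mul_prod_erase Finset.univ (fun a' => (f a').den) (Finset.mem_univ a), Nat.cast_mul,
      Nat.cast_prod, mul_comm ((f a).den : ℚ), mul_assoc, mul_comm ((f a).den : ℚ), Rat.mul_den_eq_num,
      Int.cast_mul, Int.cast_prod]
    simp only [Int.cast_natCast]

/-- Entries of `Σₗ Σₘ βₘₗ · (Dₘ Bₗ)` lie in `N·ℤ̂` when the `βₘₗ` do and `Bₗ, Dₘ` are integer matrices.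
[cite: PlatonovRapinchuk1994, §8.1] -/
theorem forall_mem_levelIdeal_sum_smul_intMul {Nn : ℕ} (D B : ι → Matrix N N ℤ) (β : Matrix ι ι finAdeleQ)
    (hβ : ∀ m l, β m l ∈ levelIdeal Nn) :
    ∀ i k, (∑ l, ∑ m, β m l • ((D m).map (Int.cast : ℤ → finAdeleQ) * (B l).map (Int.cast : ℤ → finAdeleQ))) i k ∈
      levelIdeal Nn := by
  intro i k
  rw [Matrix.sum_apply]
  refine AddSubgroup.sum_mem _ fun l _ => ?_
  rw [Matrix.sum_apply]
  refine AddSubgroup.sum_mem _ fun m _ => ?_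
  rw [Matrix.smul_apply, smul_eq_mul, mul_comm]
  refine mul_mem_levelIdeal_of_mem_integralAdeles ?_ (hβ m l)
  rw [Matrix.mul_apply]
  exact Subring.sum_mem _ fun a _ => Subring.mul_mem _ (intCast_mem _ _) (intCast_mem _ _)

/-- **Congruence brick.**  Let `γ, γ′ ∈ GL_N(ℚ)`, `Aₗ ∈ M_N(ℚ)`, integer matrices `Bₗ, Dₗ` with
`γ′⁻¹ = Σₗ Aₗ γ⁻¹ Bₗ` and `Aₗ γ⁻¹ = γ′⁻¹ Dₗ` (the lattice `γ′⁻¹ℤ^N = Σₗ Aₗ γ⁻¹ℤ^N`), and let `Y` be an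
adelic matrix with `Y · Aₗ = Σₘ βₘₗ · Aₘ` for coefficients `βₘₗ ∈ N·ℤ̂`.  Then every entry of
`γ′_𝔸 Y γ′_𝔸⁻¹ = Σₗ Σₘ βₘₗ Dₘ Bₗ` lies in `N·ℤ̂`. [cite: PlatonovRapinchuk1994, §8.1] -/
theorem forall_mem_levelIdeal_conj_of_sum [DecidableEq N] {Nn : ℕ} (γ γ' : GL N ℚ) (Y : Matrix N N finAdeleQ)
    (A : ι → Matrix N N ℚ) (B D : ι → Matrix N N ℤ) (β : Matrix ι ι finAdeleQ)
    (hβ : ∀ m l, β m l ∈ levelIdeal Nn)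
    (hY : ∀ l, Y * (A l).map (algebraMap ℚ finAdeleQ) = ∑ m, β m l • (A m).map (algebraMap ℚ finAdeleQ))
    (hγ' : ((γ'⁻¹ : GL N ℚ) : Matrix N N ℚ) =
      ∑ l, A l * ((γ⁻¹ : GL N ℚ) : Matrix N N ℚ) * (B l).map (Int.cast : ℤ → ℚ))
    (hD : ∀ l, A l * ((γ⁻¹ : GL N ℚ) : Matrix N N ℚ) =
      ((γ'⁻¹ : GL N ℚ) : Matrix N N ℚ) * (D l).map (Int.cast : ℤ → ℚ)) :
    ∀ i k, ((γ' : Matrix N N ℚ).map (algebraMap ℚ finAdeleQ) * Y *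
      ((γ'⁻¹ : GL N ℚ) : Matrix N N ℚ).map (algebraMap ℚ finAdeleQ)) i k ∈ levelIdeal Nn := by
  classical
  set φ : Matrix N N ℚ →+* Matrix N N finAdeleQ := (algebraMap ℚ finAdeleQ).mapMatrix with hφ
  have hφapp : ∀ Z : Matrix N N ℚ, Z.map (algebraMap ℚ finAdeleQ) = φ Z := fun Z => rfl
  have hφint : ∀ Z : Matrix N N ℤ, φ (Z.map (Int.cast : ℤ → ℚ)) = Z.map (Int.cast : ℤ → finAdeleQ) := by
    intro Z
    rw [← hφapp, Matrix.map_map]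
    ext i k
    simp only [Matrix.map_apply, Function.comp_apply, map_intCast]
  have hQQ' : φ (γ' : Matrix N N ℚ) * φ ((γ'⁻¹ : GL N ℚ) : Matrix N N ℚ) = 1 := by
    rw [← map_mul, ← Units.val_mul, mul_inv_cancel, Units.val_one, map_one]
  rw [hφapp, hφapp]
  -- `γ′ Y γ′⁻¹ = Σₗ Σₘ βₘₗ Dₘ Bₗ`
  have key : φ (γ' : Matrix N N ℚ) * Y * φ ((γ'⁻¹ : GL N ℚ) : Matrix N N ℚ) =
      ∑ l, ∑ m, β m l • ((D m).map (Int.cast : ℤ → finAdeleQ) * (B l).map (Int.cast : ℤ → finAdeleQ)) := by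
    rw [hγ', map_sum, Matrix.mul_sum]
    refine Finset.sum_congr rfl fun l _ => ?_
    rw [map_mul, map_mul, hφint, ← hφapp (A l)]
    calc φ (γ' : Matrix N N ℚ) * Y * ((A l).map (algebraMap ℚ finAdeleQ) *
          φ ((γ⁻¹ : GL N ℚ) : Matrix N N ℚ) * (B l).map (Int.cast : ℤ → finAdeleQ))
        = φ (γ' : Matrix N N ℚ) * (Y * (A l).map (algebraMap ℚ finAdeleQ)) *
          φ ((γ⁻¹ : GL N ℚ) : Matrix N N ℚ) * (B l).map (Int.cast : ℤ → finAdeleQ) := by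
          simp only [Matrix.mul_assoc]
      _ = ∑ m, β m l • (φ (γ' : Matrix N N ℚ) * ((A m).map (algebraMap ℚ finAdeleQ) *
          φ ((γ⁻¹ : GL N ℚ) : Matrix N N ℚ)) * (B l).map (Int.cast : ℤ → finAdeleQ)) := by
          rw [hY l, Matrix.mul_sum, Matrix.sum_mul, Matrix.sum_mul]
          refine Finset.sum_congr rfl fun m _ => ?_
          rw [Matrix.mul_smul, Matrix.smul_mul, Matrix.smul_mul]
          simp only [Matrix.mul_assoc]
      _ = ∑ m, β m l • ((D m).map (Int.cast : ℤ → finAdeleQ) * (B l).map (Int.cast : ℤ → finAdeleQ)) := by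
          refine Finset.sum_congr rfl fun m _ => ?_
          rw [hφapp, ← map_mul, hD m, map_mul, ← Matrix.mul_assoc, hQQ', Matrix.one_mul, hφint]
  rw [key]
  exact forall_mem_levelIdeal_sum_smul_intMul D B β hβ

/-- **Congruence brick, `IsCongOne` form**: under the hypotheses of `forall_mem_levelIdeal_conj_of_sum`,
`γ′_𝔸 (1 + Y) γ′_𝔸⁻¹ ≡ 1 (mod N)`. [cite: PlatonovRapinchuk1994, §8.1] [cite: Deligne1971TravauxShimura, Exemple 4.16 p. 150] -/
theorem isCongOne_conj_one_add_of_sum [DecidableEq N] {Nn : ℕ} (γ γ' : GL N ℚ) (Y : Matrix N N finAdeleQ)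
    (A : ι → Matrix N N ℚ) (B D : ι → Matrix N N ℤ) (β : Matrix ι ι finAdeleQ)
    (hβ : ∀ m l, β m l ∈ levelIdeal Nn)
    (hY : ∀ l, Y * (A l).map (algebraMap ℚ finAdeleQ) = ∑ m, β m l • (A m).map (algebraMap ℚ finAdeleQ))
    (hγ' : ((γ'⁻¹ : GL N ℚ) : Matrix N N ℚ) =
      ∑ l, A l * ((γ⁻¹ : GL N ℚ) : Matrix N N ℚ) * (B l).map (Int.cast : ℤ → ℚ))
    (hD : ∀ l, A l * ((γ⁻¹ : GL N ℚ) : Matrix N N ℚ) =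
      ((γ'⁻¹ : GL N ℚ) : Matrix N N ℚ) * (D l).map (Int.cast : ℤ → ℚ)) :
    IsCongOne Nn ((γ' : Matrix N N ℚ).map (algebraMap ℚ finAdeleQ) * (1 + Y) *
      ((γ'⁻¹ : GL N ℚ) : Matrix N N ℚ).map (algebraMap ℚ finAdeleQ)) := by
  have hQQ' : (γ' : Matrix N N ℚ).map (algebraMap ℚ finAdeleQ) *
      ((γ'⁻¹ : GL N ℚ) : Matrix N N ℚ).map (algebraMap ℚ finAdeleQ) = 1 := by
    rw [← Matrix.map_mul, ← Units.val_mul, mul_inv_cancel, Units.val_one,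
      Matrix.map_one _ (map_zero _) (map_one _)]
  intro i k
  have h : (γ' : Matrix N N ℚ).map (algebraMap ℚ finAdeleQ) * (1 + Y) *
        ((γ'⁻¹ : GL N ℚ) : Matrix N N ℚ).map (algebraMap ℚ finAdeleQ) - 1 =
      (γ' : Matrix N N ℚ).map (algebraMap ℚ finAdeleQ) * Y *
        ((γ'⁻¹ : GL N ℚ) : Matrix N N ℚ).map (algebraMap ℚ finAdeleQ) := by
    rw [Matrix.mul_add, Matrix.mul_one, Matrix.add_mul, hQQ', add_sub_cancel_left]
  rw [h]
  exact forall_mem_levelIdeal_conj_of_sum γ γ' Y A B D β hβ hY hγ' hD i k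

end Literature.NumberTheory.Adeles

end
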